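import Literature.AlgebraicGeometry.Resolution.Lipman1969ProperTransform
import Literature.AlgebraicGeometry.Resolution.ExceptionalCurveDegree
import Literature.AlgebraicGeometry.Motives.CartierDivisorIntersectionCycle
import HarnessLib

/-!
# Lipman 1969 §15 b): curves contracted by `g` — PROOF of the named fact

Topic: `Literature/AlgebraicGeometry/Resolution`. PROVES the named fact `Lipman1969_15_b`
(`Resolution/Lipman1969ProperTransform.lean`, Lipman 1969 §15 b), p. 227, for an integral curve
`F = E_ζ ⊂ X'` whose image under `g : X' → X` is a closed point): `ζ ∈ excCurvePoints (g ≫ f)` and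
`(g^*D · E_ζ) = 0`. The restriction of `g^*D` to `E_ζ` represents the class pullback of `D` along the
CONSTANT morphism `E_ζ → X' → X`, which is trivial (`classPullback_linEquiv_zero_of_const`,
`classPullback_comp_linEquiv`, `classPullback_linEquiv_pullback`), and the degree on the proper
`κ(𝔪)`-curve `E_ζ` is a class invariant (`LinEquiv.degree_eq`). The hypotheses `IsBirational g`,
`Scheme.IsRegular X'` and `ringKrullDim R = 2` of the named fact are not used. No new definitions.

## References

* J. Lipman, *Rational singularities, with applications to algebraic surfaces and unique factorization*,
  Publ. Math. IHÉS 36 (1969) 195–279, §15 b) (p. 227). [Lipman1969]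
-/

noncomputable section

open CategoryTheory AlgebraicGeometry TopologicalSpace Topology IsLocalRing
open Literature.AlgebraicGeometry.Motives RatFn

universe u

namespace Literature.AlgebraicGeometry.Resolution

namespace Lipman1969_15_b_holds_aux

variable {T : Type u} [CommRing T] [IsLocalRing T] {X : Scheme.{u}} {π : X ⟶ Spec (.of T)}

/-- A closed point of a proper `X → Spec T` (`T` local) lies over the closed point (proper maps are
closed; the closed point of `Spec T` is its only closed point). [folklore] -/
private theorem base_eq_closedPoint_of_isClosed [IsProper π] {x : X} (hx : IsClosed ({x} : Set X)) :
    π.base x = closedPoint T := by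
  have himg : IsClosed ({π.base x} : Set (Spec (.of T))) := by
    have := π.isClosedMap _ hx
    rwa [Set.image_singleton] at this
  have hmax := (PrimeSpectrum.isClosed_singleton_iff_isMaximal (π.base x)).mp himg
  exact PrimeSpectrum.ext (IsLocalRing.eq_maximalIdeal hmax)

end Lipman1969_15_b_holds_aux

open Lipman1969_15_b_holds_aux in
/-- **Lipman 1969, §15 b) (p. 227) for an integral contracted curve.** If `g(ζ)` is a closed point of `X`
then `f(g(ζ)) = 𝔪` (`f` proper), so `ζ ∈ excCurvePoints (g ≫ f)`; and `(g^*D · E_ζ)` is the degree on the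
proper `κ(𝔪)`-curve `E_ζ` of the restriction of `g^*D`, whose CLASS is the class pullback of `D` along the
CONSTANT morphism `E_ζ → X' → X` (value `g(ζ)`), hence trivial (`classPullback_linEquiv_zero_of_const`);
the degree is a class invariant (`LinEquiv.degree_eq`). [cite: Lipman1969, Section 15, statement b) (p. 227)] -/
theorem Lipman1969_15_b_holds : Lipman1969_15_b.{u} := by
  intro R _ _ _ _ _ _h2 X _ _ f hf X' _ _ g _ hg _hbir _hreg D ζ hζ1 hclosed
  haveI : IsProper f := hf.isProper
  haveI : IsProper g := hg
  have hx : f.base (g.base ζ) = closedPoint R := base_eq_closedPoint_of_isClosed hclosed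
  have hζ : ζ ∈ excCurvePoints (g ≫ f) := ⟨by rw [Scheme.Hom.comp_apply]; exact hx, hζ1⟩
  refine ⟨hζ, ?_⟩
  obtain ⟨q, hq⟩ := exists_fac_specResidueField (g ≫ f) hζ.1
  haveI : IsIntegral (Over.mk q : SchemeOver (ResidueField R)).left :=
    inferInstanceAs (IsIntegral (ClosedSubvariety.ofPoint X' ζ).carrier)
  haveI : IsProper (Over.mk q : SchemeOver (ResidueField R)).hom :=
    isProper_of_fac_specResidueField (g ≫ f) hq
  have hC : Order.height (⊤ : ↥(ClosedSubvariety.ofPoint X' ζ).carrier) = 1 :=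
    height_top_ofPoint_eq_one (g ≫ f) hζ
  rw [excCurveDegree_eq_degree_of_fac (g ≫ f) hq]
  -- `E_ζ → X' → X` is constant with value `g ζ`
  have key : ∀ y : (ClosedSubvariety.ofPoint X' ζ).carrier,
      g.base ((ClosedSubvariety.ofPoint X' ζ).ι.base y) = g.base ζ := fun y => by
    have h1 : ζ ⤳ (ClosedSubvariety.ofPoint X' ζ).ι y := ClosedSubvariety.specializes_ofPoint_ι ζ y
    have h2 : g.base ζ ⤳ g.base ((ClosedSubvariety.ofPoint X' ζ).ι.base y) := h1.map g.continuous
    exact Set.mem_singleton_iff.mp (hclosed.closure_subset (specializes_iff_mem_closure.mp h2))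
  have hconst : ∀ y y' : (ClosedSubvariety.ofPoint X' ζ).carrier,
      ((ClosedSubvariety.ofPoint X' ζ).ι ≫ g) y = ((ClosedSubvariety.ofPoint X' ζ).ι ≫ g) y' := by
    intro y y'
    rw [Scheme.Hom.comp_apply, Scheme.Hom.comp_apply, key, key]
  -- the restricted divisor is linearly equivalent to `0`
  have H : ((D.pullback g).pullbackRep (ClosedSubvariety.ofPoint X' ζ).ι).LinEquiv 0 :=
    (((D.pullback g).classPullback_linEquiv_pullbackRep (ClosedSubvariety.ofPoint X' ζ).ι).symm.trans
      (((D.classPullback_linEquiv_pullback g).symm.classPullback (ClosedSubvariety.ofPoint X' ζ).ι).trans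
        ((CartierDivisor.classPullback_comp_linEquiv g (ClosedSubvariety.ofPoint X' ζ).ι D).symm.trans
          (CartierDivisor.classPullback_linEquiv_zero_of_const
            ((ClosedSubvariety.ofPoint X' ζ).ι ≫ g) hconst D))))
  exact (CartierDivisor.LinEquiv.degree_eq (C := Over.mk q) hC H).trans
    (CartierDivisor.degree_zero (C := Over.mk q))

end Literature.AlgebraicGeometry.Resolution

end
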